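import Summits.QuantumFields.BalabanUV.Beta.CombChartJointEndReflTablesAn1S2MScaled
import Summits.QuantumFields.BalabanUV.Beta.SymWardLettersAn1Scaled

/-!
# `BalabanUV.Beta.CombChartJointEndReflTablesAn1S2MWScaled` — binder row D1, chart (III″) programme (an2 g56 W-3 l.63100 (D4) «WANTED leaf-04: MWw»): **THE κ-TWIN
# MWw OF THE COMB CHAIN ROOT `CombChartJointEndReflTablesAn1S2MW`** in the ONE-κ currency of RULING R-D1-g56-4 ∕ A-1 l.63035 ∕ W-3 shape (S): literal
# `JsB12CombShSym hLc N (symTablesAn1S2w 3 Lc (κ·cΛ) κ) (κ·cΛ) cB` with the hW class (the mixed Ward binders `hM₂ hRMp hcls0 hclsS` and the border Ward binders)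
# DISCHARGED at the Λ-lock `cΛ·Lc⁴ = 2` (on the base pin, verbatim) and the B-lock `cB = −Lc¹²∕4`, for EVERY group weight `κ` — by leaf-04's
# `SymWardLettersAn1Scaled` (`hM₂_sym_smul`, `hcls_sym_smul`), an2 g56's `SymLamGroupScaling.hRMp_sym_of_lock_smul`, and an1 g43's κ-free border letters BY NAME.
# WHAT CHANGES relative to `CombChartJointEndReflTablesAn1S2MW`: nothing but these substitutions (text transformed by name; the parent's bound fine-bond index `κ`
# is renamed `κ₁`; see the parent and its chart-(II) original `RowD1JointEndSymReflTablesAn1S2MW` for the letter-by-letter account).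

HONEST FRAMING (cell contract, verbatim): «discharging `BetaPertH` makes Bałaban's UV stability UNCONDITIONAL — a real constructive-QFT
result; it is NOT the continuum limit and NOT the Clay problem.»  HONEST DEPENDENCY: continuum YM on T⁴ ⇐ BetaPertH ∧ nine spine estimates (0/9 proved);
BetaPertH ⇐ (D1) ∧ (D4) ∧ CAP+tail; G-an2-4 gates asym, D1 and NE2/3/4.
DERIVED cell leaf ([folklore] wiring BY NAME; β sub-cell, D1 formalisation swarm leaf prover 04 `b2b-balaban-beta-d1-formalise-leaf-04` gen 33, on the row
OWNER an2 g56's WANTED (D4)).  No statement of Bałaban's papers, no `[cite:]`, no `Prop` fact, no `def`; every displayed letter is a BINDER; the VALUE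
`κ = Lc¹²∕4` enters nowhere here.  HONEST: composition by name; root classes 0∕4 discharged (hW's letters are theorems, as for M‴); row D1 binders 0∕4;
ROOT M‴ p325680 and the root of record untouched; NOT D1, NOT `BetaPertH`, NOT continuum, NOT Clay.  Provenance: β sub-cell, unit
b2b-balaban-beta-d1-formalise-leaf-04 gen 33, 2026-08-25 (v1); over leaf-04's S2Mw ∕ `SymWardLettersAn1Scaled`, an2 g56's `SymLamGroupScaling`, an1 g43's
`SymWardLettersAn1` BY NAME; no existing file touched.
-/

noncomputable section

open Finset
open scoped BigOperators
open Literature.Probability.LatticeModels (Torus.proj)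
open Literature.MathematicalPhysics.QuantumFieldTheory
open Literature.MathematicalPhysics.QuantumFieldTheory.Balaban1983to89
open Literature.MathematicalPhysics.QuantumFieldTheory.Balaban1983to89.Beta
open Literature.MathematicalPhysics.QuantumFieldTheory.Balaban1983to89.Beta.VectorTailsLoc (fam kfam)
open Literature.MathematicalPhysics.QuantumFieldTheory.Balaban1983to89.Beta.VectorLegVolumeAdapter (MvE)
open ExpKernelCalculus (MKer BiLoc VertexFamily comp tr tadpole shiftK)
open PolarizationSign (reflSign WardTransversal AxisReflectionCovariant)
open KernelReflection (refK)
open ResolventReflection (bref Φ)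
open AffineAveraging (box toSite)
open AveragingContoursRooted (ctr ctrOff ctrOff_mem_box)
open OneStepResolventKernel (Fib LocStencil JetData)
open OneStepKernelFamily (KInvStep colH vertexOfK TbalOf flipK D1Tel D1Rep D1Drift)
open KernelWard (divV divW)
open StepJetData (mfNeg wilsonA)
open BalabanStepJetsSucc (mmRead wE wVH)
open SecondOrderResponse (dM W2OfK LocStencilFM)
open BalabanCompositeJets (LocStencil₂)
open BalabanStepW2 (M2Of wB2 wV4)
open WilsonBiStencil (wilsonW₂)
open WilsonVertex2Sym (wsym22)
open Summit.QuantumFields.BalabanUV.Beta.TameKernelCalculus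
open Summit.QuantumFields.BalabanUV.Beta.ChartConjugation (conjV conjW)
open Summit.QuantumFields.BalabanUV.Beta.ChartConjugationDefectEnd (conjDefect sandwichDefect)
open Summit.QuantumFields.BalabanUV.Beta.AxialDressingRooted (one_le_of_neZero)
open Summit.QuantumFields.BalabanUV.Beta.SymmetrisedDressingKernel (coDressKSymAt)
open Summit.QuantumFields.BalabanUV.Beta.AveragingWardRootedStencils (legInd)
open Summit.QuantumFields.BalabanUV.Beta.SymmetrisedStepJets (SymTables)
open Summit.QuantumFields.BalabanUV.Beta.CombChartStepJets (GcombSh ScombOf SpureCombOf JsB12CombSh0)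
open Summit.QuantumFields.BalabanUV.Beta.CombChartJointEnd (JsB12CombShSym)
open Summit.QuantumFields.BalabanUV.Beta.SpineRooted (M1Of SpureRecOf T2RecOf WrecOf)
open Summit.QuantumFields.BalabanUV.Beta.WardLocusRecursive (SrecOf)
open Summit.QuantumFields.BalabanUV.Beta.WardLocusCubic (mmSym)
open Summit.QuantumFields.BalabanUV.Beta.SymShiftedSpread (bhKStepSh)
open Summit.QuantumFields.BalabanUV.Beta.BorderedHessian (sgnK bhK stepScale diagK)
open Summit.QuantumFields.BalabanUV.Beta.E3ContactGenerator (ctGenM)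
open Summit.QuantumFields.BalabanUV.Beta.DshAn1 (Dsh)
open Summit.QuantumFields.BalabanUV.Beta.SymAveragingHessianCounts (symVhSAt symHessFFAt)
open Summit.QuantumFields.BalabanUV.Beta.SymAveragingMixedJetTables (symMixFFAt)
open Summit.QuantumFields.BalabanUV.Beta.SymSecondOrderTablesAn1 (symVh₂SAn1)
open Summit.QuantumFields.BalabanUV.Beta.SymTablesAn1S2Weighted (symTablesAn1S2w)
open Summit.QuantumFields.BalabanUV.Beta.SymMixedReflectionLetterAn1 (symRMrAn1)

open Summit.QuantumFields.BalabanUV.Beta.CombChartJointEndReflTablesAn1S2MScaled (d1Drift_JsB12CombShSym_an1TablesS2w_of_bordMixWard_bordReflLetters_D1Tel_D1Rep)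
open Summit.QuantumFields.BalabanUV.Beta.SymWardLettersAn1 (symRMAn1 hRBp_zero hBord0_sym hBord0''_sym hBordS_sym hBordS''_sym)
open Summit.QuantumFields.BalabanUV.Beta.SymLamGroupScaling (hRMp_sym_of_lock_smul)
open Summit.QuantumFields.BalabanUV.Beta.SymWardLettersAn1Scaled (hM₂_sym_smul hcls_sym_smul)

namespace Summit.QuantumFields.BalabanUV.Beta.CombChartJointEndReflTablesAn1S2MWScaled

variable {Lc : ℕ} [NeZero Lc]

/-- **ROW D1 — THE LITERAL ROOT AT THE WEIGHTED RECORD `symTablesAn1S2w 3 Lc (κ·cΛ) κ` WITH THE hW CLASS DISCHARGED** at the locks `cΛ·Lc⁴ = 2` (on the BASE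
pin, VERBATIM) and `cB = −Lc¹²∕4`, EVERY group weight `κ` — the κ-twin of `CombChartJointEndReflTablesAn1S2MW.d1Drift_…an1TablesS2_of_bordReflLetters_…_of_locks`:
S2Mw (`CombChartJointEndReflTablesAn1S2MScaled`) with `RB := 0`, `RB'' := 0`, `RM := κ • symRMAn1 Lc cΛ` (pointwise), `hcls0 := hcls_sym_smul _ cΛ κ 0`,
`hclsS := fun j => hcls_sym_smul _ cΛ κ (j+1)`, `hRBp := hRB''p := hRBp_zero`, **`hRMp := SymLamGroupScaling.hRMp_sym_of_lock_smul hΛ κ`** (the one place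
the Λ-lock is consumed — an1's `symBondWardM` at `cΛ = 2∕Lc⁴`, scaled by `parityOdd_smul`), `hBord0∕hBord0''∕hBordS∕hBordS'' := …_sym hLc` (κ-FREE border
letters of an1 g43 BY NAME), **`hM₂ := SymWardLettersAn1Scaled.hM₂_sym_smul cΛ κ`** — thirteen binders fewer than S2Mw, two unit-lock hypotheses more; the
group weight `κ` stays FREE (W-3 (S) CONSEQUENCE: nothing in the consuming leaf needs a value of κ).  At `κ = 1` this is the parent's statement.  HONEST:
composition by name; NOT D1. -/
theorem d1Drift_JsB12CombShSym_an1TablesS2w_of_bordReflLetters_D1Tel_D1Rep_of_locks (hLc : Odd Lc) (hL2 : 2 ≤ Lc) {N : ℕ} (hN : 2 ≤ N) (cΛ κ cB : ℝ)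
    -- the two unit locks of an1's TABLE-FIT tier 2 (Λ-lock of `SymMixedWardSiteLaw.symBondWardM` — on the BASE pin `cΛ`, VERBATIM; B-lock of `SymBorderWardSiteLaw.symBondWardB`); the group weight `κ` is FREE
    (hΛ : cΛ * (Lc : ℝ) ^ 4 = 2) (hcB : cB = -((Lc : ℝ) ^ 12 / 4))
    -- hR, first order: the REFLECTION letters (V-r)(H-r) of an1's concrete first-order sym tables (pinned contact generator) — an1's reflection step, displayed
    (hVfm : ∀ (α κ₁' : Fin 4) (u x z : Fin 4 → ℤ) (β m : Fin 4), symVhSAt (ctr 4 Lc) 3 Lc rfl κ₁' (bref α κ₁' u) x z (Sum.inl β) (Sum.inr m) =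
      (reflSign α κ₁' • refK (Φ (d := 3) Lc α) (symVhSAt (ctr 4 Lc) 3 Lc rfl κ₁' u + conjV (bhK (d := 3) Lc + Dsh Lc)
        ((((Lc : ℝ) ^ 4)⁻¹) • diagK (ctGenM 3 (bhK Lc + Dsh Lc) α Lc κ₁' u)))) x z (Sum.inl β) (Sum.inr m))
    (hVmf : ∀ (α κ₁' : Fin 4) (u x z : Fin 4 → ℤ) (m β : Fin 4), symVhSAt (ctr 4 Lc) 3 Lc rfl κ₁' (bref α κ₁' u) x z (Sum.inr m) (Sum.inl β) =
      (reflSign α κ₁' • refK (Φ (d := 3) Lc α) (symVhSAt (ctr 4 Lc) 3 Lc rfl κ₁' u + conjV (bhK (d := 3) Lc + Dsh Lc)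
        ((((Lc : ℝ) ^ 4)⁻¹) • diagK (ctGenM 3 (bhK Lc + Dsh Lc) α Lc κ₁' u)))) x z (Sum.inr m) (Sum.inl β))
    (hVmm : ∀ (α κ₁' : Fin 4) (u x z : Fin 4 → ℤ) (m m' : Fin 4), symVhSAt (ctr 4 Lc) 3 Lc rfl κ₁' (bref α κ₁' u) x z (Sum.inr m) (Sum.inr m') =
      (reflSign α κ₁' • refK (Φ (d := 3) Lc α) (symVhSAt (ctr 4 Lc) 3 Lc rfl κ₁' u + conjV (bhK (d := 3) Lc + Dsh Lc)
        ((((Lc : ℝ) ^ 4)⁻¹) • diagK (ctGenM 3 (bhK Lc + Dsh Lc) α Lc κ₁' u)))) x z (Sum.inr m) (Sum.inr m'))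
    (hHr : ∀ (α μ : Fin 4) (y : Fin 4 → ℤ),
      symHessFFAt (ctr 4 Lc) Lc μ (bref α μ y) = reflSign α μ • refK (Φ (d := 3) Lc α) (symHessFFAt (ctr 4 Lc) Lc μ y))
    -- the first-order contact coefficient, displayed
    (γ : ℕ → ℝ) (hγ : ∀ j, γ j = -((Lc : ℝ) ^ 8 / 2) * wVH 3 Lc j / (stepScale 3 Lc j * (Lc : ℝ) ^ 4))
    -- hR, SECOND ORDER, NOW TABLE-LEVEL: (hB0) the border table's zero field block, the second units lock, and the second-order TABLE reflection letters
    -- (level-0 letter, mixed letter ∀ j, border letter ∀ j+1), the mechanical split identities + localisations, the remainder recursion (with the four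
    -- inner sandwich-defect words of `SecondOrderInverseShapeDefect.K3_sharp_defect`) — the hypotheses of `SpineRooted.WrecOf_brefC_of_tableLetters_comb`
    (hlock2 : ∀ j, ((Lc : ℝ) ^ 8) * wV4 3 Lc (j + 1) * wVH 3 Lc (j + 1) = ((Lc : ℝ) ^ 4 * wE 3 Lc (j + 1)) ^ 2)
    (h2 : ℕ → Fin 4 → Fin 4 → (Fin 4 → ℤ) → Fin 4 → (Fin 4 → ℤ) → (Fin 4 → ℤ) → Fib 3 → ℝ)
    (R2 : ℕ → Fin 4 → Fin 4 → (Fin 4 → ℤ) → Fin 4 → (Fin 4 → ℤ) → MKer 4 (Fib 3))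
    (h0 : ∀ (α κ₁ : Fin 4) (u : Fin 4 → ℤ) (κ₁' : Fin 4) (u' : Fin 4 → ℤ),
      T2RecOf 3 Lc (GcombSh Lc) (SpureRecOf 3 Lc (symVhSAt (ctr 4 Lc) 3 Lc rfl) (symHessFFAt (ctr 4 Lc) Lc) (GcombSh Lc) ((Lc : ℝ) ^ 4) (-((Lc : ℝ) ^ 8 / 2)) (κ * cΛ)) (M1Of 3 Lc (symHessFFAt (ctr 4 Lc) Lc) (κ * cΛ)) ((Lc : ℝ) ^ 8) cB ((8 * (N : ℝ) ^ 2)⁻¹ • wsym22 N) (symVh₂SAn1 3 Lc) (κ • symMixFFAt (ctr 4 Lc) Lc) 0 κ₁ (bref α κ₁ u) κ₁' (bref α κ₁' u') =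
        (reflSign α κ₁ * reflSign α κ₁') • refK (Φ Lc α)
          (T2RecOf 3 Lc (GcombSh Lc) (SpureRecOf 3 Lc (symVhSAt (ctr 4 Lc) 3 Lc rfl) (symHessFFAt (ctr 4 Lc) Lc) (GcombSh Lc) ((Lc : ℝ) ^ 4) (-((Lc : ℝ) ^ 8 / 2)) (κ * cΛ)) (M1Of 3 Lc (symHessFFAt (ctr 4 Lc) Lc) (κ * cΛ)) ((Lc : ℝ) ^ 8) cB ((8 * (N : ℝ) ^ 2)⁻¹ • wsym22 N) (symVh₂SAn1 3 Lc) (κ • symMixFFAt (ctr 4 Lc) Lc) 0 κ₁ u κ₁' u' +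
            conjW (bhKStepSh 3 Lc (Dsh Lc) 0) (SpureRecOf 3 Lc (symVhSAt (ctr 4 Lc) 3 Lc rfl) (symHessFFAt (ctr 4 Lc) Lc) (GcombSh Lc) ((Lc : ℝ) ^ 4) (-((Lc : ℝ) ^ 8 / 2)) (κ * cΛ) 0 κ₁ u) (SpureRecOf 3 Lc (symVhSAt (ctr 4 Lc) 3 Lc rfl) (symHessFFAt (ctr 4 Lc) Lc) (GcombSh Lc) ((Lc : ℝ) ^ 4) (-((Lc : ℝ) ^ 8 / 2)) (κ * cΛ) 0 κ₁' u')
              (diagK fun p c => γ 0 * ctGenM 3 (bhK Lc + Dsh Lc) α Lc κ₁ u p c) (diagK fun p c => γ 0 * ctGenM 3 (bhK Lc + Dsh Lc) α Lc κ₁' u' p c) (diagK (h2 0 α κ₁ u κ₁' u')) +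
            R2 0 α κ₁ u κ₁' u'))
    (X2s : ℕ → Fin 4 → Fin 4 → (Fin 4 → ℤ) → Fin 4 → (Fin 4 → ℤ) → (Fin 4 → ℤ) → Fib 3 → ℝ)
    (Δ : ℕ → Fin 4 → Fin 4 → (Fin 4 → ℤ) → Fin 4 → (Fin 4 → ℤ) → MKer 4 (Fib 3))
    (hsplit : ∀ (j : ℕ) (α μ : Fin 4) (y : Fin 4 → ℤ) (ν : Fin 4) (y' : Fin 4 → ℤ),
      W2OfK (GcombSh (d := 3) Lc j) Lc
          (fun κ₁ u => SpureRecOf 3 Lc (symVhSAt (ctr 4 Lc) 3 Lc rfl) (symHessFFAt (ctr 4 Lc) Lc) (GcombSh Lc) ((Lc : ℝ) ^ 4) (-((Lc : ℝ) ^ 8 / 2)) (κ * cΛ) j κ₁ u + conjV (bhKStepSh 3 Lc (Dsh Lc) j) (diagK fun p c => γ j * ctGenM 3 (bhK Lc + Dsh Lc) α Lc κ₁ u p c))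
          (M1Of 3 Lc (symHessFFAt (ctr 4 Lc) Lc) (κ * cΛ) j)
          (fun κ₁ u κ₁' u' => T2RecOf 3 Lc (GcombSh Lc) (SpureRecOf 3 Lc (symVhSAt (ctr 4 Lc) 3 Lc rfl) (symHessFFAt (ctr 4 Lc) Lc) (GcombSh Lc) ((Lc : ℝ) ^ 4) (-((Lc : ℝ) ^ 8 / 2)) (κ * cΛ)) (M1Of 3 Lc (symHessFFAt (ctr 4 Lc) Lc) (κ * cΛ)) ((Lc : ℝ) ^ 8) cB ((8 * (N : ℝ) ^ 2)⁻¹ • wsym22 N) (symVh₂SAn1 3 Lc) (κ • symMixFFAt (ctr 4 Lc) Lc) j κ₁ u κ₁' u' +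
            conjW (bhKStepSh 3 Lc (Dsh Lc) j) (SpureRecOf 3 Lc (symVhSAt (ctr 4 Lc) 3 Lc rfl) (symHessFFAt (ctr 4 Lc) Lc) (GcombSh Lc) ((Lc : ℝ) ^ 4) (-((Lc : ℝ) ^ 8 / 2)) (κ * cΛ) j κ₁ u) (SpureRecOf 3 Lc (symVhSAt (ctr 4 Lc) 3 Lc rfl) (symHessFFAt (ctr 4 Lc) Lc) (GcombSh Lc) ((Lc : ℝ) ^ 4) (-((Lc : ℝ) ^ 8 / 2)) (κ * cΛ) j κ₁' u')
              (diagK fun p c => γ j * ctGenM 3 (bhK Lc + Dsh Lc) α Lc κ₁ u p c) (diagK fun p c => γ j * ctGenM 3 (bhK Lc + Dsh Lc) α Lc κ₁' u' p c) (diagK (h2 j α κ₁ u κ₁' u')) +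
            R2 j α κ₁ u κ₁' u')
          (fun κ₁ u ρ w => M2Of 3 Lc (κ • symMixFFAt (ctr 4 Lc) Lc) j κ₁ u ρ w + conjV (M1Of 3 Lc (symHessFFAt (ctr 4 Lc) Lc) (κ * cΛ) j ρ w) (diagK fun p c => γ j * ctGenM 3 (bhK Lc + Dsh Lc) α Lc κ₁ u p c) + κ • symRMrAn1 Lc cΛ γ j α κ₁ u ρ w)
          μ y ν y' =
        W2OfK (GcombSh (d := 3) Lc j) Lc (SpureRecOf 3 Lc (symVhSAt (ctr 4 Lc) 3 Lc rfl) (symHessFFAt (ctr 4 Lc) Lc) (GcombSh Lc) ((Lc : ℝ) ^ 4) (-((Lc : ℝ) ^ 8 / 2)) (κ * cΛ) j) (M1Of 3 Lc (symHessFFAt (ctr 4 Lc) Lc) (κ * cΛ) j)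
            (T2RecOf 3 Lc (GcombSh Lc) (SpureRecOf 3 Lc (symVhSAt (ctr 4 Lc) 3 Lc rfl) (symHessFFAt (ctr 4 Lc) Lc) (GcombSh Lc) ((Lc : ℝ) ^ 4) (-((Lc : ℝ) ^ 8 / 2)) (κ * cΛ)) (M1Of 3 Lc (symHessFFAt (ctr 4 Lc) Lc) (κ * cΛ)) ((Lc : ℝ) ^ 8) cB ((8 * (N : ℝ) ^ 2)⁻¹ • wsym22 N) (symVh₂SAn1 3 Lc) (κ • symMixFFAt (ctr 4 Lc) Lc) j)
            (M2Of 3 Lc (κ • symMixFFAt (ctr 4 Lc) Lc) j) μ y ν y' +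
          conjW (bhKStepSh 3 Lc (Dsh Lc) j)
            (dM (GcombSh Lc j) Lc (SpureRecOf 3 Lc (symVhSAt (ctr 4 Lc) 3 Lc rfl) (symHessFFAt (ctr 4 Lc) Lc) (GcombSh Lc) ((Lc : ℝ) ^ 4) (-((Lc : ℝ) ^ 8 / 2)) (κ * cΛ) j) (M1Of 3 Lc (symHessFFAt (ctr 4 Lc) Lc) (κ * cΛ) j) μ y)
            (dM (GcombSh Lc j) Lc (SpureRecOf 3 Lc (symVhSAt (ctr 4 Lc) 3 Lc rfl) (symHessFFAt (ctr 4 Lc) Lc) (GcombSh Lc) ((Lc : ℝ) ^ 4) (-((Lc : ℝ) ^ 8 / 2)) (κ * cΛ) j) (M1Of 3 Lc (symHessFFAt (ctr 4 Lc) Lc) (κ * cΛ) j) ν y')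
            (diagK fun p c => ∑ κ₁, ∑' u, colH (GcombSh Lc j) Lc μ y κ₁ u * (γ j * ctGenM 3 (bhK Lc + Dsh Lc) α Lc κ₁ u p c))
            (diagK fun p c => ∑ κ₁, ∑' u, colH (GcombSh Lc j) Lc ν y' κ₁ u * (γ j * ctGenM 3 (bhK Lc + Dsh Lc) α Lc κ₁ u p c))
            (diagK (X2s j α μ y ν y')) +
          Δ j α μ y ν y')
    (hDg : ∀ (j : ℕ) (α ν : Fin 4) (y' : Fin 4 → ℤ),
      Loc (dM (GcombSh (d := 3) Lc j) Lc (fun κ₁ u => SpureRecOf 3 Lc (symVhSAt (ctr 4 Lc) 3 Lc rfl) (symHessFFAt (ctr 4 Lc) Lc) (GcombSh Lc) ((Lc : ℝ) ^ 4) (-((Lc : ℝ) ^ 8 / 2)) (κ * cΛ) j κ₁ u + conjV (bhKStepSh 3 Lc (Dsh Lc) j) (diagK fun p c => γ j * ctGenM 3 (bhK Lc + Dsh Lc) α Lc κ₁ u p c)) (M1Of 3 Lc (symHessFFAt (ctr 4 Lc) Lc) (κ * cΛ) j) ν y'))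
    (hX2L : ∀ j α μ y ν y', Loc (diagK (X2s j α μ y ν y'))) (hΔL : ∀ j α μ y ν y', Loc (Δ j α μ y ν y'))
    (RBr : ℕ → Fin 4 → Fin 4 → (Fin 4 → ℤ) → Fin 4 → (Fin 4 → ℤ) → MKer 4 (Fib 3))
    (hRBrff : ∀ j α κ₁ u κ₁' u' (x z : Fin 4 → ℤ) (β β' : Fin 4), RBr j α κ₁ u κ₁' u' x z (Sum.inl β) (Sum.inl β') = 0)
    (hBfm : ∀ (j : ℕ) (α : Fin 4) κ₁ u κ₁' u' (x z : Fin 4 → ℤ) (β m : Fin 4),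
      ((cB * wB2 3 Lc (j + 1)) • symVh₂SAn1 3 Lc κ₁ (bref α κ₁ u) κ₁' (bref α κ₁' u')) x z (Sum.inl β) (Sum.inr m) =
        ((reflSign α κ₁ * reflSign α κ₁') • refK (Φ Lc α) ((cB * wB2 3 Lc (j + 1)) • symVh₂SAn1 3 Lc κ₁ u κ₁' u' +
          conjW (bhKStepSh 3 Lc (Dsh Lc) (j + 1)) (SpureRecOf 3 Lc (symVhSAt (ctr 4 Lc) 3 Lc rfl) (symHessFFAt (ctr 4 Lc) Lc) (GcombSh Lc) ((Lc : ℝ) ^ 4) (-((Lc : ℝ) ^ 8 / 2)) (κ * cΛ) (j + 1) κ₁ u) (SpureRecOf 3 Lc (symVhSAt (ctr 4 Lc) 3 Lc rfl) (symHessFFAt (ctr 4 Lc) Lc) (GcombSh Lc) ((Lc : ℝ) ^ 4) (-((Lc : ℝ) ^ 8 / 2)) (κ * cΛ) (j + 1) κ₁' u')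
            (diagK fun p c => γ (j + 1) * ctGenM 3 (bhK Lc + Dsh Lc) α Lc κ₁ u p c) (diagK fun p c => γ (j + 1) * ctGenM 3 (bhK Lc + Dsh Lc) α Lc κ₁' u' p c)
            (diagK (h2 (j + 1) α κ₁ u κ₁' u')) + RBr (j + 1) α κ₁ u κ₁' u')) x z (Sum.inl β) (Sum.inr m))
    (hBmf : ∀ (j : ℕ) (α : Fin 4) κ₁ u κ₁' u' (x z : Fin 4 → ℤ) (m β : Fin 4),
      ((cB * wB2 3 Lc (j + 1)) • symVh₂SAn1 3 Lc κ₁ (bref α κ₁ u) κ₁' (bref α κ₁' u')) x z (Sum.inr m) (Sum.inl β) =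
        ((reflSign α κ₁ * reflSign α κ₁') • refK (Φ Lc α) ((cB * wB2 3 Lc (j + 1)) • symVh₂SAn1 3 Lc κ₁ u κ₁' u' +
          conjW (bhKStepSh 3 Lc (Dsh Lc) (j + 1)) (SpureRecOf 3 Lc (symVhSAt (ctr 4 Lc) 3 Lc rfl) (symHessFFAt (ctr 4 Lc) Lc) (GcombSh Lc) ((Lc : ℝ) ^ 4) (-((Lc : ℝ) ^ 8 / 2)) (κ * cΛ) (j + 1) κ₁ u) (SpureRecOf 3 Lc (symVhSAt (ctr 4 Lc) 3 Lc rfl) (symHessFFAt (ctr 4 Lc) Lc) (GcombSh Lc) ((Lc : ℝ) ^ 4) (-((Lc : ℝ) ^ 8 / 2)) (κ * cΛ) (j + 1) κ₁' u')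
            (diagK fun p c => γ (j + 1) * ctGenM 3 (bhK Lc + Dsh Lc) α Lc κ₁ u p c) (diagK fun p c => γ (j + 1) * ctGenM 3 (bhK Lc + Dsh Lc) α Lc κ₁' u' p c)
            (diagK (h2 (j + 1) α κ₁ u κ₁' u')) + RBr (j + 1) α κ₁ u κ₁' u')) x z (Sum.inr m) (Sum.inl β))
    (hBmm : ∀ (j : ℕ) (α : Fin 4) κ₁ u κ₁' u' (x z : Fin 4 → ℤ) (m m' : Fin 4),
      ((cB * wB2 3 Lc (j + 1)) • symVh₂SAn1 3 Lc κ₁ (bref α κ₁ u) κ₁' (bref α κ₁' u')) x z (Sum.inr m) (Sum.inr m') =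
        ((reflSign α κ₁ * reflSign α κ₁') • refK (Φ Lc α) ((cB * wB2 3 Lc (j + 1)) • symVh₂SAn1 3 Lc κ₁ u κ₁' u' +
          conjW (bhKStepSh 3 Lc (Dsh Lc) (j + 1)) (SpureRecOf 3 Lc (symVhSAt (ctr 4 Lc) 3 Lc rfl) (symHessFFAt (ctr 4 Lc) Lc) (GcombSh Lc) ((Lc : ℝ) ^ 4) (-((Lc : ℝ) ^ 8 / 2)) (κ * cΛ) (j + 1) κ₁ u) (SpureRecOf 3 Lc (symVhSAt (ctr 4 Lc) 3 Lc rfl) (symHessFFAt (ctr 4 Lc) Lc) (GcombSh Lc) ((Lc : ℝ) ^ 4) (-((Lc : ℝ) ^ 8 / 2)) (κ * cΛ) (j + 1) κ₁' u')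
            (diagK fun p c => γ (j + 1) * ctGenM 3 (bhK Lc + Dsh Lc) α Lc κ₁ u p c) (diagK fun p c => γ (j + 1) * ctGenM 3 (bhK Lc + Dsh Lc) α Lc κ₁' u' p c)
            (diagK (h2 (j + 1) α κ₁ u κ₁' u')) + RBr (j + 1) α κ₁ u κ₁' u')) x z (Sum.inr m) (Sum.inr m'))
    (hR2succ : ∀ (j : ℕ) (α κ₁ : Fin 4) (u : Fin 4 → ℤ) (κ₁' : Fin 4) (u' : Fin 4 → ℤ),
      R2 (j + 1) α κ₁ u κ₁' u' =
          (-((((Lc : ℝ) ^ 8) * wV4 3 Lc (j + 1)) • mmRead Lc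
              (comp (comp (GcombSh Lc j) (((1 / 2 : ℝ) • conjV (bhKStepSh 3 Lc (Dsh Lc) j) (diagK fun p a => X2s j α κ₁' u' κ₁ u p a - X2s j α κ₁ u κ₁' u' p a) +
                (1 / 2 : ℝ) • (Δ j α κ₁ u κ₁' u' + Δ j α κ₁' u' κ₁ u)))) (GcombSh Lc j) -
                (comp (sandwichDefect (GcombSh Lc j) (bhKStepSh 3 Lc (Dsh Lc) j)
                      (diagK fun p c => ∑ ι, ∑' v, colH (GcombSh Lc j) Lc κ₁ u ι v * (γ j * ctGenM 3 (bhK Lc + Dsh Lc) α Lc ι v p c)))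
                    (comp (dM (GcombSh Lc j) Lc (SpureRecOf 3 Lc (symVhSAt (ctr 4 Lc) 3 Lc rfl) (symHessFFAt (ctr 4 Lc) Lc) (GcombSh Lc) ((Lc : ℝ) ^ 4) (-((Lc : ℝ) ^ 8 / 2)) (κ * cΛ) j) (M1Of 3 Lc (symHessFFAt (ctr 4 Lc) Lc) (κ * cΛ) j) κ₁' u') (GcombSh Lc j) -
                      diagK fun p c => ∑ ι, ∑' v, colH (GcombSh Lc j) Lc κ₁' u' ι v * (γ j * ctGenM 3 (bhK Lc + Dsh Lc) α Lc ι v p c))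
                  + comp (comp (GcombSh Lc j) (dM (GcombSh Lc j) Lc (SpureRecOf 3 Lc (symVhSAt (ctr 4 Lc) 3 Lc rfl) (symHessFFAt (ctr 4 Lc) Lc) (GcombSh Lc) ((Lc : ℝ) ^ 4) (-((Lc : ℝ) ^ 8 / 2)) (κ * cΛ) j) (M1Of 3 Lc (symHessFFAt (ctr 4 Lc) Lc) (κ * cΛ) j) κ₁ u +
                      conjV (bhKStepSh 3 Lc (Dsh Lc) j) (diagK fun p c => ∑ ι, ∑' v, colH (GcombSh Lc j) Lc κ₁ u ι v * (γ j * ctGenM 3 (bhK Lc + Dsh Lc) α Lc ι v p c))))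
                    (sandwichDefect (GcombSh Lc j) (bhKStepSh 3 Lc (Dsh Lc) j)
                      (diagK fun p c => ∑ ι, ∑' v, colH (GcombSh Lc j) Lc κ₁' u' ι v * (γ j * ctGenM 3 (bhK Lc + Dsh Lc) α Lc ι v p c)))
                  + comp (sandwichDefect (GcombSh Lc j) (bhKStepSh 3 Lc (Dsh Lc) j)
                      (diagK fun p c => ∑ ι, ∑' v, colH (GcombSh Lc j) Lc κ₁' u' ι v * (γ j * ctGenM 3 (bhK Lc + Dsh Lc) α Lc ι v p c)))
                    (comp (dM (GcombSh Lc j) Lc (SpureRecOf 3 Lc (symVhSAt (ctr 4 Lc) 3 Lc rfl) (symHessFFAt (ctr 4 Lc) Lc) (GcombSh Lc) ((Lc : ℝ) ^ 4) (-((Lc : ℝ) ^ 8 / 2)) (κ * cΛ) j) (M1Of 3 Lc (symHessFFAt (ctr 4 Lc) Lc) (κ * cΛ) j) κ₁ u) (GcombSh Lc j) -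
                      diagK fun p c => ∑ ι, ∑' v, colH (GcombSh Lc j) Lc κ₁ u ι v * (γ j * ctGenM 3 (bhK Lc + Dsh Lc) α Lc ι v p c))
                  + comp (comp (GcombSh Lc j) (dM (GcombSh Lc j) Lc (SpureRecOf 3 Lc (symVhSAt (ctr 4 Lc) 3 Lc rfl) (symHessFFAt (ctr 4 Lc) Lc) (GcombSh Lc) ((Lc : ℝ) ^ 4) (-((Lc : ℝ) ^ 8 / 2)) (κ * cΛ) j) (M1Of 3 Lc (symHessFFAt (ctr 4 Lc) Lc) (κ * cΛ) j) κ₁' u' +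
                      conjV (bhKStepSh 3 Lc (Dsh Lc) j) (diagK fun p c => ∑ ι, ∑' v, colH (GcombSh Lc j) Lc κ₁' u' ι v * (γ j * ctGenM 3 (bhK Lc + Dsh Lc) α Lc ι v p c))))
                    (sandwichDefect (GcombSh Lc j) (bhKStepSh 3 Lc (Dsh Lc) j)
                      (diagK fun p c => ∑ ι, ∑' v, colH (GcombSh Lc j) Lc κ₁ u ι v * (γ j * ctGenM 3 (bhK Lc + Dsh Lc) α Lc ι v p c)))))) +
            RBr (j + 1) α κ₁ u κ₁' u' +
            conjV (mmRead Lc (GcombSh (d := 3) Lc j))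
              (diagK fun p c => ((Lc : ℝ) ^ 8) * wV4 3 Lc (j + 1) * mmSym Lc (X2s j α κ₁ u κ₁' u') p c - wVH 3 Lc (j + 1) * h2 (j + 1) α κ₁ u κ₁' u' p c)))
    -- the cancellation of the chart-(II) defect against the W-REMAINDER `Rm_j` (the compensator is now IDENTIFIED: `Wc := Rm`, `X₂ := diagK X2s`) — the (N8) object
    (hRm0 : ∀ (j : ℕ) (α μ : Fin 4) (y : Fin 4 → ℤ) (ν : Fin 4) (y' : Fin 4 → ℤ),
      tadpole (GcombSh Lc j)
        ((1 / 2 : ℝ) • conjV (bhKStepSh 3 Lc (Dsh Lc) j) (diagK fun p a => X2s j α ν y' μ y p a - X2s j α μ y ν y' p a) +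
          (1 / 2 : ℝ) • (Δ j α μ y ν y' + Δ j α ν y' μ y)) = 0)
    -- the route theorem's own binders, verbatim
    (a : ℝ) (ha : 0 < a)
    (h12 : B5.Prop12Printed (fam (fun i : ℕ+ × ℕ => ((i.1 : ℕ+) : ℕ)) (fun i => i.1.pos) MvE a ha))
    (h126 : B5.Kernel126_127Printed (kfam (fun i : ℕ+ × ℕ => ((i.1 : ℕ+) : ℕ)) MvE))
    {L : Type*} {SL : Finset L} (hSL : SL.Nonempty) (k : L → Fin 4) {μ ν : Fin 4} (hμν : μ ≠ ν) {Nc : ℝ} (hNc : Nc ≠ 0)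
    (Jc : ∀ m : ℕ, JetData 3 (Lc ^ m))
    (htel : D1Tel Lc (JsB12CombShSym hLc N (symTablesAn1S2w 3 Lc (κ * cΛ) κ) (κ * cΛ) cB) Jc)
    {cc : ℝ} {Mw' : ℕ → ℕ} (hc : 1 ≤ cc) (hMwin : ∀ L : ℕ, 2 ≤ L → 1 ≤ Mw' L ∧ (L : ℝ) ≤ cc * Mw' L) (hML : ∀ L : ℕ, 2 ≤ L → Mw' L ≤ L)
    (hrep : D1Rep Lc Jc Nc μ ν a SL k) :
    D1Drift Lc (JsB12CombShSym hLc N (symTablesAn1S2w 3 Lc (κ * cΛ) κ) (κ * cΛ) cB) Nc μ ν := by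
  subst hcB
  have hLc1 : 1 ≤ Lc := le_trans one_le_two hL2
  exact d1Drift_JsB12CombShSym_an1TablesS2w_of_bordMixWard_bordReflLetters_D1Tel_D1Rep hLc hL2 hN cΛ κ (-((Lc : ℝ) ^ 12 / 4)) 0 0
    (fun j y ρ' w => κ • symRMAn1 Lc cΛ j y ρ' w) (hcls_sym_smul hLc1 cΛ κ 0) (fun j => hcls_sym_smul hLc1 cΛ κ (j + 1)) hRBp_zero hRBp_zero
    (hRMp_sym_of_lock_smul hΛ κ) (hBord0_sym hLc) (hBord0''_sym hLc) (hBordS_sym hLc) (hBordS''_sym hLc) (hM₂_sym_smul cΛ κ) hVfm hVmf hVmm hHr γ hγ hlock2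
    h2 R2 h0 X2s Δ hsplit hDg hX2L hΔL RBr hRBrff hBfm hBmf hBmm hR2succ hRm0 a ha h12 h126 hSL k hμν hNc Jc htel hc hMwin hML hrep

end Summit.QuantumFields.BalabanUV.Beta.CombChartJointEndReflTablesAn1S2MWScaled

end
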